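import Literature.AlgebraicGeometry.Motives.JacobianAbelJacobiSum
import Literature.AlgebraicGeometry.Motives.WeilJacobianAbelTheorem
import HarnessLib

/-!
# Abel's theorem for the Abel–Jacobi sum of any Jacobian, from Weil's model

Layer `Literature/AlgebraicGeometry/Motives`, namespace `Literature.AlgebraicGeometry.Motives.Jacobian`.  THEOREMS ONLY (no definition,
no named fact, no instance).

Let `C` be a smooth projective (geometrically integral) curve over an algebraically closed field `K` of characteristic `0`, `Jac` Weil's
Jacobian of `C` with its map `f : C → Jac`, `Q ↦ [Q − R₀(j₀)]` (`Motives/WeilJacobian*`), and `𝒥 : Jacobian C` ANY Jacobian of `C` in the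
sense of the universal property (`Motives/Jacobian`).  Given a homomorphism **`v : Jac → 𝒥.J` with `f ≫ v = α_{R₀(j₀)}`** (the
Abel–Jacobi map of `𝒥` at the base point `R₀(j₀)`) — which exists, uniquely, as soon as Weil's `(Jac, f)` is known to have the universal
property of Milne, *Jacobian Varieties* Prop. 6.1 (sibling leaf; then `v` is the canonical isomorphism `Jacobian.uniqueUpToIso`) — we prove:

* `ajSum_baseTuple_eq_map_prod_fJ` — `aj_{R₀(j₀)}(E) = v(∏_P f(P)^{ord_P E})`: the Abel–Jacobi sum of `Motives/JacobianAbelJacobiSum` is the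
  image under `v` of the corresponding product on Weil's model (`v` is a homomorphism on `K`-points);
* **`ajSum_principal_of_weilModel`** — **ABEL'S THEOREM `aj_c(div h) = 1`** for every base point `c ∈ C(K)` and every `h ∈ K(C)^×`:
  at `c = R₀(j₀)` it is `v(1) = 1` by Abel's theorem on Weil's model (`WeilJacobian.prod_fJ_zpow_ordAt_principal_eq_one`,
  `Motives/WeilJacobianAbelTheorem`), and the base point is irrelevant on divisors of total multiplicity `0`
  (`ajSum_eq_of_sum_ordAt_eq_zero`, `WeilJacobian.sum_ordAt_principal_eq_zero`);
* `ajSum_congr_linEquiv_of_weilModel` — hence `aj_c` is an invariant of the linear equivalence class.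

These are the letters (g4-1d)/(g4-1e) of the road-G4 programme (cell `hodgecm-mathlib`, D-0151; `G4.sockets` §0) in the conditional
form «given `v`»; the sibling leaf (W1) supplies `v`.  Milne, *Jacobian Varieties* Thm. 1.1 / §6 Prop. 6.1 / §7 Thm. 7.1; Lange, *Abelian
Varieties over the Complex Numbers* §4.1.3 Thm. 4.1.4 («by a theorem of Abel its kernel is the subgroup of principal divisors»).
HC_CM is proved only modulo the 7 printed citations until rung 0 closes; this file moves no book.

## References
* [Milne1986JacobianVarieties] J. S. Milne, *Jacobian Varieties*, in Cornell–Silverman (eds.), *Arithmetic Geometry* (1986), Thm. 1.1,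
  §6 Prop. 6.1, §7 Thm. 7.1.
* [Lange2023AbelianVarietiesComplex] H. Lange, *Abelian Varieties over the Complex Numbers* (2023), §4.1.3 Thm. 4.1.4 (p. 206).
-/

set_option autoImplicit false

noncomputable section

universe u

open CategoryTheory CategoryTheory.Limits AlgebraicGeometry MonoidalCategory CartesianMonoidalCategory MonObj
open Literature.NumberTheory.DiophantineGeometry
open Literature.NumberTheory.DiophantineGeometry.AlgFunctionField
open Literature.AlgebraicGeometry.RelativeSpec

namespace Literature.AlgebraicGeometry.Motives

open RatFn FieldPoint CartierDivisor CurvePlaces WeilJacobian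

namespace Jacobian

variable {K : Type u} [Field K] [IsAlgClosed K] [CharZero K]
  {C : SchemeOver K} [IsIntegral C.left] [SmoothOfRelativeDimension 1 C.hom] [IsProper C.hom]
  [GeometricallyIntegral C.hom] (hC : IsProjectiveOver C) (hX : CechPseudoCoherentAt C) (g : ℕ)
  (hg : (genus K (curveBC C (strPt (K := K) K)).left.functionField : ℤ) ≤ g)
  (hW : (chartW C g hC).Nonempty) (j₀ : Fin g) (𝒥 : Jacobian C)

omit [IsAlgClosed K] [CharZero K] [SmoothOfRelativeDimension 1 C.hom] [IsProper C.hom] [GeometricallyIntegral C.hom] in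
/-- A homomorphism of abelian varieties pushes a finite product of powers of `K`-points through: `v(∏ Pᵢ^{nᵢ}) = ∏ v(Pᵢ)^{nᵢ}`
(`v` is a group homomorphism on `K`-points, Mathlib `IsMonHom.monoidHom`). [folklore] -/
private theorem map_prod_zpow {A B : AbelianVariety K} (w : A ⟶ B) {α : Type*} (s : Finset α)
    (P : α → A.Points K) (n : α → ℤ) :
    AlgPoints.map w.hom.hom.hom (∏ i ∈ s, P i ^ n i) = ∏ i ∈ s, (AlgPoints.map w.hom.hom.hom (P i)) ^ n i := by
  have h := map_prod (IsMonHom.monoidHom w.hom.hom.hom (specOver K K)) (fun i => P i ^ n i) s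
  simp only [map_zpow, IsMonHom.monoidHom_apply] at h
  simpa only [AlgPoints.map_apply] using h

omit [IsAlgClosed K] [CharZero K] [IsIntegral C.left] [SmoothOfRelativeDimension 1 C.hom] [GeometricallyIntegral C.hom] in
/-- Local instance: the curve is locally Noetherian (locally of finite type over a field). [folklore] -/
private theorem isLocallyNoetherian_left : IsLocallyNoetherian C.left := by
  haveI : LocallyOfFiniteType C.hom := inferInstance
  exact LocallyOfFiniteType.isLocallyNoetherian C.hom

/-- **`aj_{R₀(j₀)}(E) = v(∏_{P ∈ s} f(P)^{ord_P E})`**: the Abel–Jacobi sum of `𝒥` at the base point `R₀(j₀)` is the image under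
`v : Jac → 𝒥.J` of the product on Weil's model (any finite `s` containing the support). [cite: Milne1986JacobianVarieties, §6 Prop. 6.1 and §7 (the map C → J)] -/
theorem ajSum_baseTuple_eq_map_prod_fJ (v : Jac C hC hX g hg hW ⟶ 𝒥.J)
    (hv : fJ C hC hX g hg hW j₀ ≫ v.hom.hom.hom = 𝒥.abelJacobi (baseTuple C hC hX g hW j₀))
    (E : CartierDivisor C.left) (s : Finset (AlgPoints C K))
    (hs : ∀ P : AlgPoints C K, (haveI := isLocallyNoetherian_left (C := C); E.ordAt P.pt) ≠ 0 → P ∈ s) :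
    haveI := isLocallyNoetherian_left (C := C)
    𝒥.ajSum (baseTuple C hC hX g hW j₀) E =
      AlgPoints.map v.hom.hom.hom (∏ P ∈ s, (AlgPoints.map (fJ C hC hX g hg hW j₀) P) ^ (E.ordAt P.pt)) := by
  haveI := isLocallyNoetherian_left (C := C)
  rw [𝒥.ajSum_eq_finset_prod _ E s hs, map_prod_zpow]
  refine Finset.prod_congr rfl fun P _ => ?_
  rw [AlgPoints.map_apply, AlgPoints.map_apply, AlgPoints.map_apply, Category.assoc, hv]

/-- **ABEL'S THEOREM** for the Abel–Jacobi sum of an arbitrary Jacobian `𝒥` of `C`, given a homomorphism `v : Jac → 𝒥.J` from Weil's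
model carrying `f` to `α_{R₀(j₀)}`: **`aj_c(div h) = 1`** for every base point `c ∈ C(K)` and every `h ∈ K(C)^×` — at `c = R₀(j₀)`
it is `v(∏ f(P)^{ord_P h}) = v(1) = 1` (Abel on Weil's model), and `Σ_P ord_P(h) = 0` makes the base point irrelevant.
[cite: Milne1986JacobianVarieties, Thm. 1.1 and §7 Thm. 7.1] [cite: Lange2023AbelianVarietiesComplex, §4.1.3 Thm. 4.1.4 (p. 206)] -/
theorem ajSum_principal_of_weilModel (v : Jac C hC hX g hg hW ⟶ 𝒥.J)
    (hv : fJ C hC hX g hg hW j₀ ≫ v.hom.hom.hom = 𝒥.abelJacobi (baseTuple C hC hX g hW j₀))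
    (c : AlgPoints C K) {h : C.left.functionField} (hh : h ≠ 0) :
    haveI := isLocallyNoetherian_left (C := C)
    𝒥.ajSum c (CartierDivisor.principal h hh) = 1 := by
  classical
  haveI := isLocallyNoetherian_left (C := C)
  -- a finite set containing the support of `div h`
  obtain ⟨s, hs⟩ : ∃ s : Finset (AlgPoints C K), ∀ P : AlgPoints C K, (CartierDivisor.principal h hh).ordAt P.pt ≠ 0 → P ∈ s :=
    ⟨(finite_setOf_ordAt_pt_ne_zero (C := C) (CartierDivisor.principal h hh)).toFinset,
      fun P hP => (Set.Finite.mem_toFinset _).mpr hP⟩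
  -- the base point is irrelevant: `Σ_P ord_P(h) = 0`
  rw [𝒥.ajSum_eq_of_sum_ordAt_eq_zero (baseTuple C hC hX g hW j₀) c _ s hs
    (WeilJacobian.sum_ordAt_principal_eq_zero C hh s hs),
    ajSum_baseTuple_eq_map_prod_fJ hC hX g hg hW j₀ 𝒥 v hv _ s hs,
    WeilJacobian.prod_fJ_zpow_ordAt_principal_eq_one C hC hX g hg hW j₀ hh s hs, AlgPoints.map_apply, MonObj.one_comp]

/-- **`aj_c` is an invariant of the linear equivalence class** (given `v` as above): `E ∼ F ⟹ aj_c(E) = aj_c(F)` — from Abel's theorem,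
additivity and `SameDivisor`-invariance. [cite: Milne1986JacobianVarieties, Thm. 1.1] [cite: Lange2023AbelianVarietiesComplex, §4.1.3 Thm. 4.1.4 (p. 206)] -/
theorem ajSum_congr_linEquiv_of_weilModel (v : Jac C hC hX g hg hW ⟶ 𝒥.J)
    (hv : fJ C hC hX g hg hW j₀ ≫ v.hom.hom.hom = 𝒥.abelJacobi (baseTuple C hC hX g hW j₀))
    (c : AlgPoints C K) {E F : CartierDivisor C.left}
    (hEF : (haveI := isLocallyNoetherian_left (C := C); E.LinEquiv F)) :
    haveI := isLocallyNoetherian_left (C := C)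
    𝒥.ajSum c E = 𝒥.ajSum c F := by
  haveI := isLocallyNoetherian_left (C := C)
  obtain ⟨h, hh, hsame⟩ := hEF
  rw [← 𝒥.ajSum_congr_sameDivisor c hsame, 𝒥.ajSum_add, ajSum_principal_of_weilModel hC hX g hg hW j₀ 𝒥 v hv c hh, _root_.mul_one]

end Jacobian

end Literature.AlgebraicGeometry.Motives

end
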